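import Mathlib
import Summits.ValiantsHypothesis.ValiantsHypothesis.Theorems.DivisionGapPerMultiplesHardStubBregmanFibre
import Summits.ValiantsHypothesis.ValiantsHypothesis.Theorems.DivisionGapPerMultiplesHardStubLogFactorialJensen
import Summits.ValiantsHypothesis.ValiantsHypothesis.Theorems.DivisionGapPerMultiplesHardStubStirlingGamma
import Literature.Combinatorics.Enumerative.BregmanMinc
import Literature.Combinatorics.Enumerative.EntropyBregman

/-!
# `DivisionGap.PerMultiplesHard` (stmt-ValiantsHypothesis-5068), line `uncharged-face-walk`:
the analytic half of stub `stub_relDenseHost` (Jensen + Stirling bookkeeping for Brégman fibres)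

The conditional dense-host kill (`RelDenseHost.stub_relDenseHost`, file
`DivisionGapPerMultiplesHardRelDenseHost.lean`) bounds a block-diagonal fibre of `PM(Y)` by
Brégman–Minc, `#Fib ≤ ∏_j (D_j !)^{1/D_j}` (`BregmanFibre.stub_bregmanFibre`), and needs the
estimate

  `∏_j (D_j !)^{1/D_j} ≤ β^n · u! · (n-u)! · exp (15 ε n/β + (log n + 12)/β)`     (`fib_le`)

whenever all `D_j ≥ 1`, `Σ_{j ∈ T} D_j ≤ β u² + ε n²`, `Σ_{j ∉ T} D_j ≤ β (n-u)² + ε n²`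
(`u = #T`, `n < 10 u`, `5 u ≤ 4 n`, `0 < β ≤ 1`, `0 ≤ ε ≤ 1`).  This file proves it:

* `(D !)^{1/D} = exp (γ(D))` with `γ(D) = log (D !)/D` (`BregmanFibre.factorial_rpow_eq_exp`);
* JENSEN over a Finset (`jensen_finset`, from the tangent-line pieces
  `LogFactorialJensen.le_tangent_of_gap_succ_le`, `LogFactorialJensen.log_factorial_div_gap_succ_le`
  and the monotonicity `Literature.Combinatorics.Enumerative.log_factorial_div_mono`): for
  `d_j ≥ 1` on `s` with `Σ_{j ∈ s} d_j ≤ #s · D`, `Σ_{j ∈ s} γ(d_j) ≤ #s · γ(D)`; the level used is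
  `D := max (e/v + 1) ⌈β v⌉₊` (`part_le`);
* STIRLING (`gamma_level_bound`): `γ(D) ≤ log D - 1 + (log D)/(2D) + 1/D`
  (`StirlingGamma.stub_stirlingGamma`), `v log v - v ≤ log (v !)`
  (the tree's `Literature.Combinatorics.Enumerative.cast_mul_log_sub_le_log_factorial`), `log (1 + x) ≤ x` and `log 16 ≤ 4`, giving per
  part `v γ(D) ≤ v log β + log (v !) + K ε n/β + (log n)/(2β) + 4/β` with `K = 10` on `T`
  (`n ≤ 10 u`) and `K = 5` on `Tᶜ` (`n ≤ 5 (n - u)`); the two parts add up to the claim with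
  `8/β ≤ 12/β` to spare;
* double counting (`sum_card_filter_eq_card_filter`, `sum_degT`, `sum_degC`) identifies the degree
  sums of Brégman's degree family with the edge counts `e_Y(U, T)`, `e_Y(Uᶜ, Tᶜ)` that the mixing
  hypothesis of the stub controls.
-/

noncomputable section

-- `Summit.ValiantsHypothesis.ValiantsHypothesis.…` is the tree's mandated layout (Sub = Summit).
set_option linter.dupNamespace false

namespace Summit.ValiantsHypothesis.ValiantsHypothesis.Theorems.DivisionGap.PerMultiplesHard.RelDenseHostAux

open Literature.Combinatorics.Enumerative
open scoped BigOperators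

/-! ### Double counting and the Finset form of Jensen -/

/-- Double counting the cells of `Y` in the rectangle `A × B` by columns:
`Σ_{j ∈ B} #{i ∈ A : (i, j) ∈ Y} = #{e ∈ Y : e.1 ∈ A, e.2 ∈ B}`. [folklore] -/
theorem sum_card_filter_eq_card_filter {n : ℕ} (Y : Finset (Fin n × Fin n))
    (A B : Finset (Fin n)) :
    ∑ j ∈ B, (A.filter fun i => (i, j) ∈ Y).card =
      (Y.filter fun e => e.1 ∈ A ∧ e.2 ∈ B).card := by
  have h : (Y.filter fun e => e.1 ∈ A ∧ e.2 ∈ B) = (A ×ˢ B).filter fun e => e ∈ Y := by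
    ext e
    simp only [Finset.mem_filter, Finset.mem_product]
    tauto
  rw [h, Finset.card_filter, Finset.sum_product_right]
  exact Finset.sum_congr rfl fun j _ => Finset.card_filter _ _

/-- Discrete Jensen from a tangent line, Finset form: if `f m ≤ f D + s · (m - D)` for all
`m ≥ 1` with a slope `s ≥ 0`, then `Σ_{b ∈ t} f (d_b) ≤ #t · f D` whenever `d_b ≥ 1` on `t`
and `Σ_{b ∈ t} d_b ≤ #t · D`. [folklore] -/
theorem finset_sum_le_card_mul_of_tangent {ι : Type*} (f : ℕ → ℝ) (D : ℕ) (sl : ℝ)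
    (hs : 0 ≤ sl) (htan : ∀ m : ℕ, 1 ≤ m → f m ≤ f D + sl * ((m : ℝ) - D)) (t : Finset ι)
    (d : ι → ℕ) (hd : ∀ b ∈ t, 1 ≤ d b) (hsum : ∑ b ∈ t, d b ≤ t.card * D) :
    ∑ b ∈ t, f (d b) ≤ (t.card : ℝ) * f D := by
  have h1 : ∑ b ∈ t, f (d b) ≤ ∑ b ∈ t, (f D + sl * ((d b : ℝ) - D)) :=
    Finset.sum_le_sum fun b hb => htan (d b) (hd b hb)
  have h2 : ∑ b ∈ t, (f D + sl * ((d b : ℝ) - D)) =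
      (t.card : ℝ) * f D + sl * (∑ b ∈ t, (d b : ℝ) - t.card * D) := by
    rw [Finset.sum_add_distrib, Finset.sum_const, nsmul_eq_mul, ← Finset.mul_sum,
      Finset.sum_sub_distrib, Finset.sum_const, nsmul_eq_mul]
  have h3 : ∑ b ∈ t, (d b : ℝ) ≤ (t.card : ℝ) * D := by exact_mod_cast hsum
  have h4 : sl * (∑ b ∈ t, (d b : ℝ) - t.card * D) ≤ 0 :=
    mul_nonpos_of_nonneg_of_nonpos hs (by linarith)
  linarith

/-- **Jensen for the Brégman exponent, Finset form.**  For integers `d_j ≥ 1` (`j ∈ t`) with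
`Σ_{j ∈ t} d_j ≤ #t · D`, `D ≥ 1`:  `Σ_{j ∈ t} log (d_j !) / d_j ≤ #t · log (D !) / D`
(`γ(d) = log (d !) / d` is monotone, `log_factorial_div_mono`, and concave on `d ≥ 1`,
`LogFactorialJensen.log_factorial_div_gap_succ_le`, so it lies below its tangent line at `D`,
`LogFactorialJensen.le_tangent_of_gap_succ_le`). [folklore] -/
theorem jensen_finset {ι : Type*} (t : Finset ι) (d : ι → ℕ) (D : ℕ) (hD : 1 ≤ D)
    (hd : ∀ j ∈ t, 1 ≤ d j) (hsum : ∑ j ∈ t, d j ≤ t.card * D) :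
    ∑ j ∈ t, Real.log ((d j).factorial : ℝ) / (d j : ℝ) ≤
      (t.card : ℝ) * (Real.log (D.factorial : ℝ) / (D : ℝ)) := by
  have hs : 0 ≤ Real.log ((D + 1).factorial : ℝ) / ((D + 1 : ℕ) : ℝ) -
      Real.log (D.factorial : ℝ) / (D : ℝ) :=
    sub_nonneg.mpr (log_factorial_div_mono (Nat.le_succ D))
  exact finset_sum_le_card_mul_of_tangent (fun m : ℕ => Real.log (m.factorial : ℝ) / (m : ℝ))
    D _ hs (fun m hm => LogFactorialJensen.le_tangent_of_gap_succ_le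
      (fun m : ℕ => Real.log (m.factorial : ℝ) / (m : ℝ))
      LogFactorialJensen.log_factorial_div_gap_succ_le hD hm) t d hd hsum

/-! ### The Stirling estimate of one Jensen level -/

/-- **The Stirling estimate of one Jensen level.**  For `0 < β`, integers `v, n, D ≥ 1` and a
real `c` with `β v ≤ D ≤ β v + c + 1` and `D ≤ 16 n`:
`v · log (D !) / D ≤ v log β + log (v !) + c/β + (log n)/(2β) + 4/β`.
Indeed `log (D !)/D ≤ log D - 1 + (log D)/(2D) + 1/D` (`StirlingGamma.stub_stirlingGamma`),
`v/D ≤ 1/β`, `log D ≤ log (β v) + (c + 1)/(β v)` (`log (1 + x) ≤ x`), `log D ≤ log n + 4`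
(`log 16 ≤ 4`) and `v log v - v ≤ log (v !)`. [folklore] -/
theorem gamma_level_bound (β c : ℝ) (n v D : ℕ) (hβ : 0 < β) (hv : 1 ≤ v) (hn : 1 ≤ n)
    (hD : 1 ≤ D) (hlo : β * v ≤ D) (hhi : (D : ℝ) ≤ β * v + c + 1)
    (h16 : (D : ℝ) ≤ 16 * n) :
    (v : ℝ) * (Real.log (D.factorial : ℝ) / (D : ℝ)) ≤
      (v : ℝ) * Real.log β + Real.log (v.factorial : ℝ) + c / β + Real.log n / (2 * β) +
        4 / β := by
  have hD0 : (0 : ℝ) < D := by exact_mod_cast hD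
  have hv0 : (0 : ℝ) < v := by exact_mod_cast hv
  have hn0 : (0 : ℝ) < n := by exact_mod_cast hn
  have hDne : (D : ℝ) ≠ 0 := hD0.ne'
  have hvne : (v : ℝ) ≠ 0 := hv0.ne'
  have hβne : β ≠ 0 := hβ.ne'
  have hβv : 0 < β * v := mul_pos hβ hv0
  -- (1) Stirling from above, divided by `D`
  have hst := StirlingGamma.stub_stirlingGamma D hD
  have hγ : Real.log (D.factorial : ℝ) / (D : ℝ) ≤
      Real.log D - 1 + Real.log D / (2 * D) + 1 / D := by
    have e : Real.log D - 1 + Real.log D / (2 * D) + 1 / D =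
        ((D : ℝ) * Real.log D - D + Real.log D / 2 + 1) / D := by
      field_simp
    rw [e, div_le_div_iff_of_pos_right hD0]
    exact hst
  -- (2) `0 ≤ log D ≤ log n + 4`
  have hlogD : 0 ≤ Real.log D := Real.log_nonneg (by exact_mod_cast hD)
  have hlog2 : Real.log 2 ≤ 1 := by
    have := Real.log_le_sub_one_of_pos (show (0 : ℝ) < 2 by norm_num)
    linarith
  have hlogDn : Real.log D ≤ Real.log n + 4 := by
    calc Real.log D ≤ Real.log (16 * n) := Real.log_le_log hD0 h16
      _ = Real.log ((2 : ℝ) ^ 4) + Real.log n := by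
          rw [Real.log_mul (by norm_num) hn0.ne']
          norm_num
      _ = 4 * Real.log 2 + Real.log n := by
          rw [Real.log_pow]
          norm_num
      _ ≤ Real.log n + 4 := by linarith
  -- (3) `log D ≤ log β + log v + (c + 1)/(β v)`
  have hlogD2 : Real.log D ≤ Real.log β + Real.log v + (c + 1) / (β * v) := by
    have h1 : Real.log (D / (β * v)) ≤ D / (β * v) - 1 :=
      Real.log_le_sub_one_of_pos (div_pos hD0 hβv)
    rw [Real.log_div hDne hβv.ne', Real.log_mul hβne hvne] at h1
    have h2 : (D : ℝ) / (β * v) - 1 ≤ (c + 1) / (β * v) := by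
      rw [sub_le_iff_le_add, div_add_one hβv.ne', div_le_div_iff_of_pos_right hβv]
      linarith
    linarith
  -- (4) Stirling from below for `v`
  have hlow := Literature.Combinatorics.Enumerative.cast_mul_log_sub_le_log_factorial v
  -- (5) assemble
  have hvD : (v : ℝ) / D ≤ 1 / β := by
    rw [div_le_div_iff₀ hD0 hβ]
    linarith
  have hA : (v : ℝ) * Real.log D ≤ v * (Real.log β + Real.log v) + (c + 1) / β := by
    have h1 := mul_le_mul_of_nonneg_left hlogD2 hv0.le
    have e : (v : ℝ) * (Real.log β + Real.log v + (c + 1) / (β * v)) =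
        v * (Real.log β + Real.log v) + (c + 1) / β := by
      field_simp
    linarith
  have hB : (v : ℝ) / D * (Real.log D / 2) ≤ 1 / β * ((Real.log n + 4) / 2) :=
    mul_le_mul hvD (by linarith) (by positivity) (by positivity)
  have hvD' : (v : ℝ) * (1 / D) ≤ 1 / β := by rwa [← div_eq_mul_one_div]
  calc (v : ℝ) * (Real.log (D.factorial : ℝ) / (D : ℝ))
      ≤ v * (Real.log D - 1 + Real.log D / (2 * D) + 1 / D) :=
        mul_le_mul_of_nonneg_left hγ hv0.le
    _ = v * Real.log D - v + v / D * (Real.log D / 2) + v * (1 / D) := by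
        field_simp
    _ ≤ (v * (Real.log β + Real.log v) + (c + 1) / β) - v + 1 / β * ((Real.log n + 4) / 2) +
          1 / β := by linarith
    _ = v * Real.log β + ((v : ℝ) * Real.log v - v) + c / β + Real.log n / (2 * β) + 4 / β := by
        field_simp
        ring
    _ ≤ _ := by linarith

/-- **One part of the exponent.**  For a column set `s` (`#s = v ≥ 1`, `n ≤ K v`, `K ≤ 10`)
and degrees `d_j ≥ 1` on `s` with `Σ_{j ∈ s} d_j ≤ β v² + ε n²` (`0 < β ≤ 1`, `0 ≤ ε ≤ 1`):
`Σ_{j ∈ s} log (d_j !)/d_j ≤ v log β + log (v !) + K ε n/β + (log n)/(2β) + 4/β`.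
Jensen (`jensen_finset`) at the level `D := max (e/v + 1) ⌈β v⌉₊` (`e := Σ d_j ≤ v D`,
`β v ≤ D ≤ β v + ε n²/v + 1 ≤ 16 n`), then `gamma_level_bound` with `c := ε n²/v ≤ K ε n`.
[folklore] -/
theorem part_le {n : ℕ} (s : Finset (Fin n)) (d : Fin n → ℕ) (β ε K : ℝ) (hβ : 0 < β)
    (hβ1 : β ≤ 1) (hε : 0 ≤ ε) (hε1 : ε ≤ 1) (hK : K ≤ 10) (hn : 1 ≤ n) (hs : 1 ≤ s.card)
    (hKs : (n : ℝ) ≤ K * s.card) (hd : ∀ j ∈ s, 1 ≤ d j)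
    (he : ((∑ j ∈ s, d j : ℕ) : ℝ) ≤ β * s.card * s.card + ε * (n : ℝ) ^ 2) :
    ∑ j ∈ s, Real.log ((d j).factorial : ℝ) / (d j : ℝ) ≤
      (s.card : ℝ) * Real.log β + Real.log (s.card.factorial : ℝ) + K * ε * n / β +
        Real.log n / (2 * β) + 4 / β := by
  -- the level `D`
  obtain ⟨v, hv⟩ : ∃ v : ℕ, v = s.card := ⟨_, rfl⟩
  obtain ⟨e, he_def⟩ : ∃ e : ℕ, e = ∑ j ∈ s, d j := ⟨_, rfl⟩
  obtain ⟨D, hD⟩ : ∃ D : ℕ, D = max (e / v + 1) ⌈β * v⌉₊ := ⟨_, rfl⟩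
  rw [← hv] at hs hKs he ⊢
  rw [← he_def] at he
  have hv0 : 0 < v := hs
  have hvR : (0 : ℝ) < v := by exact_mod_cast hv0
  have hnR : (0 : ℝ) < n := by exact_mod_cast hn
  have hD1 : 1 ≤ D := by rw [hD]; exact le_max_of_le_left (Nat.le_add_left 1 _)
  -- `Σ d ≤ v · D`
  have hsum : ∑ j ∈ s, d j ≤ s.card * D := by
    rw [← he_def, ← hv]
    have h1 : e < e / v * v + v := Nat.lt_div_mul_add hv0
    have h2 : e / v * v + v = v * (e / v + 1) := by ring
    have h3 : v * (e / v + 1) ≤ v * D := Nat.mul_le_mul_left _ (by rw [hD]; exact le_max_left _ _)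
    omega
  -- Jensen
  have hJ := jensen_finset s d D hD1 hd hsum
  rw [← hv] at hJ
  -- bounds on `D` over `ℝ`
  have hlo : β * v ≤ D := by
    calc β * v ≤ (⌈β * v⌉₊ : ℝ) := Nat.le_ceil _
      _ ≤ D := by rw [hD]; exact_mod_cast le_max_right _ _
  have hev : (e : ℝ) ≤ (β * v + ε * (n : ℝ) ^ 2 / v) * v := by
    have : (β * v + ε * (n : ℝ) ^ 2 / v) * v = β * v * v + ε * (n : ℝ) ^ 2 := by
      field_simp
    rw [this]
    exact he
  have hhi : (D : ℝ) ≤ β * v + ε * (n : ℝ) ^ 2 / v + 1 := by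
    have h1 : ((e / v : ℕ) : ℝ) ≤ (e : ℝ) / v := Nat.cast_div_le
    have h2 : (e : ℝ) / v ≤ β * v + ε * (n : ℝ) ^ 2 / v := by rwa [div_le_iff₀ hvR]
    have h3 : (⌈β * v⌉₊ : ℝ) < β * v + 1 := Nat.ceil_lt_add_one (by positivity)
    have h4 : 0 ≤ ε * (n : ℝ) ^ 2 / v := by positivity
    rw [hD, Nat.cast_max, Nat.cast_add, Nat.cast_one]
    exact max_le (by linarith) (by linarith)
  have hvn : v ≤ n := by
    have := s.card_le_univ
    rwa [Fintype.card_fin, ← hv] at this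
  have hvnR : (v : ℝ) ≤ n := by exact_mod_cast hvn
  have hK0 : 0 ≤ K := by
    by_contra hK0
    have : K * v < 0 := mul_neg_of_neg_of_pos (not_le.mp hK0) hvR
    linarith
  have hcK : ε * (n : ℝ) ^ 2 / v ≤ K * ε * n := by
    rw [div_le_iff₀ hvR]
    have h1 : (n : ℝ) ^ 2 ≤ K * v * n := by nlinarith
    calc ε * (n : ℝ) ^ 2 ≤ ε * (K * v * n) := mul_le_mul_of_nonneg_left h1 hε
      _ = K * ε * n * v := by ring
  have hc10 : ε * (n : ℝ) ^ 2 / v ≤ 10 * n := by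
    have h1 : K * ε ≤ 10 := by
      have := mul_le_mul_of_nonneg_left hε1 hK0
      linarith [mul_one K]
    calc ε * (n : ℝ) ^ 2 / v ≤ K * ε * n := hcK
      _ ≤ 10 * n := mul_le_mul_of_nonneg_right h1 hnR.le
  have h16 : (D : ℝ) ≤ 16 * n := by
    have h1 : β * v ≤ v := mul_le_of_le_one_left hvR.le hβ1
    have hn1 : (1 : ℝ) ≤ n := by exact_mod_cast hn
    linarith
  have hmain := gamma_level_bound β (ε * (n : ℝ) ^ 2 / v) n v D hβ hs hn hD1 hlo hhi h16
  have hcβ : ε * (n : ℝ) ^ 2 / v / β ≤ K * ε * n / β :=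
    (div_le_div_iff_of_pos_right hβ).mpr hcK
  linarith

/-! ### The fibre bound -/

/-- Double counting on `T`: the `T`-degrees of Brégman's degree family sum to `e_Y(U, T)`.
[folklore] -/
theorem sum_degT {n : ℕ} (Y : Finset (Fin n × Fin n)) (T U : Finset (Fin n)) :
    ∑ j ∈ T, (if j ∈ T then U.filter (fun i => (i, j) ∈ Y)
        else Uᶜ.filter (fun i => (i, j) ∈ Y)).card =
      (Y.filter fun e => e.1 ∈ U ∧ e.2 ∈ T).card := by
  rw [← sum_card_filter_eq_card_filter]
  exact Finset.sum_congr rfl fun j hj => by rw [if_pos hj]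

/-- Double counting on `Tᶜ`: the `Tᶜ`-degrees of Brégman's degree family sum to `e_Y(Uᶜ, Tᶜ)`.
[folklore] -/
theorem sum_degC {n : ℕ} (Y : Finset (Fin n × Fin n)) (T U : Finset (Fin n)) :
    ∑ j ∈ Tᶜ, (if j ∈ T then U.filter (fun i => (i, j) ∈ Y)
        else Uᶜ.filter (fun i => (i, j) ∈ Y)).card =
      (Y.filter fun e => e.1 ∈ Uᶜ ∧ e.2 ∈ Tᶜ).card := by
  rw [← sum_card_filter_eq_card_filter]
  exact Finset.sum_congr rfl fun j hj => by rw [if_neg (Finset.mem_compl.mp hj)]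

/-- **The fibre bound.**  If `X ≤ ∏_j (r_j !)^{1/r_j}` with all `r_j ≥ 1`,
`Σ_{j ∈ T} r_j ≤ β u² + ε n²`, `Σ_{j ∉ T} r_j ≤ β (n-u)² + ε n²` (`u := #T`, `n < 10 u`,
`5 u ≤ 4 n`, `0 < β ≤ 1`, `0 ≤ ε ≤ 1`), then
`X ≤ β^n · u! · (n-u)! · exp (15 ε n/β + (log n + 12)/β)`: write the product as
`exp (Σ_j log (r_j !)/r_j)` (`BregmanFibre.factorial_rpow_eq_exp`), split the sum over `T` and
`Tᶜ` and apply `part_le` with `K = 10` resp. `K = 5`. [folklore] -/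
theorem fib_le :
    ∀ {n : ℕ} (T : Finset (Fin n)) (β ε X : ℝ) (r : Fin n → ℕ),
      0 < β → β ≤ 1 → 0 ≤ ε → ε ≤ 1 →
      X ≤ ∏ j, (((r j).factorial : ℕ) : ℝ) ^ ((1 : ℝ) / (r j : ℝ)) →
      (∀ j, 1 ≤ r j) →
      ((∑ j ∈ T, r j : ℕ) : ℝ) ≤ β * T.card * T.card + ε * (n : ℝ) ^ 2 →
      ((∑ j ∈ Tᶜ, r j : ℕ) : ℝ) ≤ β * Tᶜ.card * Tᶜ.card + ε * (n : ℝ) ^ 2 →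
      n < 10 * T.card → 5 * T.card ≤ 4 * n →
      X ≤ β ^ n * ((T.card.factorial : ℝ) * ((n - T.card).factorial : ℝ)) *
        Real.exp (15 * ε * n / β + (Real.log n + 12) / β) := by
  intro n T β ε X r hβ hβ1 hε hε1 hX hr hT hTc h10 h5
  have hun : T.card ≤ n := by
    have := T.card_le_univ
    rwa [Fintype.card_fin] at this
  have hu1 : 1 ≤ T.card := by omega
  have hn1 : 1 ≤ n := by omega
  have hTcc : Tᶜ.card = n - T.card := by rw [Finset.card_compl, Fintype.card_fin]
  have hnu1 : 1 ≤ Tᶜ.card := by rw [hTcc]; omega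
  -- the product as an exponential
  rw [Finset.prod_congr rfl fun j _ => BregmanFibre.factorial_rpow_eq_exp (r j),
    ← Real.exp_sum] at hX
  -- the two parts
  have h10R : (n : ℝ) ≤ 10 * (T.card : ℝ) := by exact_mod_cast h10.le
  have hA := part_le T r β ε 10 hβ hβ1 hε hε1 le_rfl hn1 hu1 h10R (fun j _ => hr j) hT
  have hcast : ((Tᶜ.card : ℕ) : ℝ) = n - T.card := by rw [hTcc, Nat.cast_sub hun]
  have h5R : (n : ℝ) ≤ 5 * (Tᶜ.card : ℝ) := by
    rw [hcast]
    have : ((5 * T.card : ℕ) : ℝ) ≤ ((4 * n : ℕ) : ℝ) := by exact_mod_cast h5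
    push_cast at this
    linarith
  have hB := part_le Tᶜ r β ε 5 hβ hβ1 hε hε1 (by norm_num) hn1 hnu1 h5R (fun j _ => hr j) hTc
  rw [hTcc] at hB
  rw [hTcc] at hcast
  rw [hcast] at hB
  -- combine
  have hsplit := Finset.sum_add_sum_compl T
    (fun j => Real.log (((r j).factorial : ℕ) : ℝ) / (r j : ℝ))
  have e2 : (n : ℝ) * Real.log β =
      (T.card : ℝ) * Real.log β + ((n : ℝ) - T.card) * Real.log β := by ring
  have h4 : 0 ≤ 4 / β := by positivity
  have htot : ∑ j, Real.log (((r j).factorial : ℕ) : ℝ) / (r j : ℝ) ≤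
      Real.log (β ^ n) + Real.log (T.card.factorial : ℝ) +
        Real.log ((n - T.card).factorial : ℝ) +
        (15 * ε * n / β + (Real.log n + 12) / β) := by
    rw [← hsplit, Real.log_pow]
    have e1 : 15 * ε * n / β + (Real.log n + 12) / β =
        10 * ε * n / β + 5 * ε * n / β + Real.log n / (2 * β) + Real.log n / (2 * β) +
          4 / β + 4 / β + 4 / β := by
      field_simp
      ring
    rw [e1]
    linarith
  have hf1 : (0 : ℝ) < (T.card.factorial : ℝ) := by exact_mod_cast Nat.factorial_pos _
  have hf2 : (0 : ℝ) < ((n - T.card).factorial : ℝ) := by exact_mod_cast Nat.factorial_pos _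
  calc X ≤ _ := hX
    _ ≤ Real.exp (Real.log (β ^ n) + Real.log (T.card.factorial : ℝ) +
          Real.log ((n - T.card).factorial : ℝ) +
          (15 * ε * n / β + (Real.log n + 12) / β)) := Real.exp_le_exp.mpr htot
    _ = β ^ n * ((T.card.factorial : ℝ) * ((n - T.card).factorial : ℝ)) *
          Real.exp (15 * ε * n / β + (Real.log n + 12) / β) := by
        rw [Real.exp_add, Real.exp_add, Real.exp_add, Real.exp_log (pow_pos hβ n),
          Real.exp_log hf1, Real.exp_log hf2]
        ring

end Summit.ValiantsHypothesis.ValiantsHypothesis.Theorems.DivisionGap.PerMultiplesHard.RelDenseHostAux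

end
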